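import Summits.NavierStokesRegularity.NavierStokesRegularity.Theorems.CoriolisHeadNoCoRotatingCoreKFoldExtremeRotation
import Literature.Analysis.FluidPDE.PineauVicolCylinderRegularity
import HarnessLib

/-!
# CoriolisHeadNoCoRotatingCorePVProfileDerivativeBounds — crux `NoCoRotatingCore` (stmt-NavierStokesRegularity-22676):
# Pineau–Vicol's Lemma 2.1 (2.1) in the PROFILE frame with α-UNIFORM constants (the planner's open input [d] `PVLemma21`)

Support file (`--supports stmt-NavierStokesRegularity-22676 --as helper`; theorems only).  The crux idea «alpha-m-shift»
(ns-idea-10 g5) typed, in `Cruxes/NoCoRotatingCore/AlphaMShiftWirtinger.lean § Skeleton`, the open input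

  `PVLemma21 : ∀ K > 0, ∃ K₁ K₂, ∀ (α, U, P), IsPVProfile α U P → (∀ y, ‖U y‖ ≤ K/(1+‖y‖)) → PVDecay12 K₁ K₂ U`,
  `PVDecay12 K₁ K₂ U : ∀ y, ‖DU(y)‖ ≤ K₁/(1+‖y‖²) ∧ ‖D(DU)(y)‖ ≤ K₂/(1+‖y‖³)`

— Pineau–Vicol 2026, Lemma 2.1, estimate (2.1), with the quantifier order `∃ K₁ K₂ ∀ α` that the critic of record flagged as
the one place where the rung could fail (N60 (3): "`C_{U,1}, C_{U,2}` must not depend on `α` or `k`").  THIS FILE PROVES IT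
(`pv_profile_derivative_bounds`, statement = `PVLemma21` with `IsPVProfile`/`PVDecay12` unfolded verbatim): the ansatz field of the
profile is a classical Type-I(`K`) Navier–Stokes solution on `(−∞,0) × ℝ³` (`exists_isClassicalNSSolutionOn_pvAnsatz_of_profile`,
`hasTypeIDecay_pvAnsatz_of_profile`), the tree's α-free interior regularity of Type-I classical solutions
(`PineauVicol2026.exists_forall_iteratedFDeriv_le_of_typeI`: `‖Dⁿu(t,·)(x)‖ ≤ Kₙ(C₀) max{‖x‖, √(−t)}^{−(n+1)}`, constants depending on
`C₀` and `n` ONLY — the rotation rate never enters because the Navier–Stokes equations do not see it) is read at `t = −1`, where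
`u(−1,·) = U`, and `max{‖y‖,1}^{−m} ≤ 2/(1+‖y‖^m)`.  Also recorded: the sup-norm form (`pv_profile_sup_bounds`, the shape of the
toolkit's record `PVBounds U K'`: `‖U‖, ‖DU‖, ‖D²U‖ ≤ K'(K)`), and all orders (`pv_profile_iteratedFDeriv_bounds`).

HONEST FRAMING.  Regularity bookkeeping for hypothetical profiles; after `kFoldExtremeRotation_liouville` (p652397) the rung no
longer needs it, but every PV-§6-type attack on the window does.  `NoCoRotatingCore`, PV Conjecture 1.1 and NS regularity are NOT
proved.

References: B. Pineau, V. Vicol, arXiv:2607.09619 (2026), Lemma 2.1 (2.1), Remark 1.3, Lemma 7.1 (7.2) [PineauVicol2026];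
crux work file `Cruxes/NoCoRotatingCore/AlphaMShiftWirtinger.lean` § Skeleton (ns-idea-10 g5).
-/

noncomputable section

-- the summit and its single sub-problem share the name (CONVENTIONS §1), as in every Theorems file
set_option linter.dupNamespace false

open Set Function Filter
open Literature.Analysis.FluidPDE Literature.Analysis.FluidPDE.PineauVicol2026
open scoped RealInnerProductSpace Laplacian ContDiff Topology

namespace Summit.NavierStokesRegularity.NavierStokesRegularity.Theorems.CoriolisHead

/-- `max{r, 1}^{−m} ≤ 2/(1 + r^m)` for `r ≥ 0`. [folklore] -/
theorem inv_max_one_pow_le_two_div {r : ℝ} (hr : 0 ≤ r) (m : ℕ) :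
    ((max r 1)⁻¹) ^ m ≤ 2 / (1 + r ^ m) := by
  have hm1 : 1 ≤ max r 1 := le_max_right _ _
  have hm0 : 0 < max r 1 := one_pos.trans_le hm1
  have h1 : r ^ m ≤ (max r 1) ^ m := pow_le_pow_left₀ hr (le_max_left _ _) m
  have h2 : (1 : ℝ) ≤ (max r 1) ^ m := one_le_pow₀ hm1
  have hpos : 0 < 1 + r ^ m := by positivity
  rw [inv_pow, inv_eq_one_div, div_le_div_iff₀ (pow_pos hm0 m) hpos]
  linarith

/-- **All-orders α-uniform derivative bounds for Pineau–Vicol profiles** (PV Lemma 2.1 / (7.2) in the profile frame): for every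
`n` and every Type-I constant `K` there is `Kₙ ≥ 0` such that EVERY smooth solution `(U, P)` (`U ∈ C^∞`, `P ∈ C²`, `∇·U = 0`) of the
Pineau–Vicol-frame profile system at ANY rate `α` with `‖U(y)‖ ≤ K/(1+‖y‖)` obeys `‖DⁿU(y)‖ ≤ Kₙ · max{‖y‖,1}^{−(n+1)}`.
[cite: PineauVicol2026, Lemma 2.1 (2.1) and Lemma 7.1 (7.2) (arXiv:2607.09619 pp. 9, 24)] -/
theorem pv_profile_iteratedFDeriv_bounds (n : ℕ) (K : ℝ) :
    ∃ Kₙ : ℝ, 0 ≤ Kₙ ∧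
      ∀ (α : ℝ) (U : EuclideanSpace ℝ (Fin 3) → EuclideanSpace ℝ (Fin 3)) (P : EuclideanSpace ℝ (Fin 3) → ℝ),
        ContDiff ℝ (⊤ : ℕ∞) U → ContDiff ℝ 2 P → Literature.Analysis.FluidPDE.VectorCalculus.IsDivFree U →
        (∀ y, α • (rotGen (U y) - fderiv ℝ U y (rotGen y)) + (1 / 2 : ℝ) • U y
            + (1 / 2 : ℝ) • fderiv ℝ U y y - Laplacian.laplacian U y
            + Literature.Analysis.FluidPDE.convect U U y + gradient P y = 0) →
        (∀ y, ‖U y‖ ≤ K / (1 + ‖y‖)) →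
        ∀ y, ‖iteratedFDeriv ℝ n U y‖ ≤ Kₙ * ((max ‖y‖ 1)⁻¹) ^ (n + 1) := by
  obtain ⟨Kₙ, hKₙ0, hKₙ⟩ := exists_forall_iteratedFDeriv_le_of_typeI n K
  refine ⟨Kₙ, hKₙ0, fun α U P hU hP hdiv heq hdec y => ?_⟩
  obtain ⟨p, hp⟩ := exists_isClassicalNSSolutionOn_pvAnsatz_of_profile hU hP hdiv heq
  have hI : ∀ t ∈ Iio (0 : ℝ), ∀ x : EuclideanSpace ℝ (Fin 3),
      ‖pvAnsatz α (fun y _ => U y) t x‖ ≤ K / (‖x‖ + Real.sqrt (-t)) :=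
    fun t ht x => hasTypeIDecay_pvAnsatz_of_profile (α := α) hdec t ht x
  have hwU : pvAnsatz α (fun y _ => U y) (-1) = U := funext fun x => pvAnsatz_neg_one α _ x
  have h := hKₙ _ p hp hI (-1) (by norm_num) y
  rwa [hwU, neg_neg, Real.sqrt_one] at h

/-- **[d] `PVLemma21` of the alpha-m-shift skeleton — PROVED (PV Lemma 2.1, (2.1), profile frame, α-UNIFORM):** for every
`K > 0` there are `K₁, K₂` (depending on `K` ONLY) such that every smooth solution `(U, P)` of the Pineau–Vicol-frame rotated
profile system at any rate `α` with the Type-I decay `‖U(y)‖ ≤ K/(1+‖y‖)` satisfies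
`‖DU(y)‖ ≤ K₁/(1+‖y‖²)` and `‖D(DU)(y)‖ ≤ K₂/(1+‖y‖³)` for all `y`.  Statement = `Skeleton.PVLemma21` of
`Cruxes/NoCoRotatingCore/AlphaMShiftWirtinger.lean` with `IsPVProfile`, `PVDecay12` unfolded.
[cite: PineauVicol2026, Lemma 2.1 (2.1) (arXiv:2607.09619 p. 9)] -/
theorem pv_profile_derivative_bounds :
    ∀ K : ℝ, 0 < K → ∃ K₁ K₂ : ℝ,
      ∀ (α : ℝ) (U : EuclideanSpace ℝ (Fin 3) → EuclideanSpace ℝ (Fin 3)) (P : EuclideanSpace ℝ (Fin 3) → ℝ),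
        (ContDiff ℝ (⊤ : ℕ∞) U ∧ ContDiff ℝ 2 P ∧ Literature.Analysis.FluidPDE.VectorCalculus.IsDivFree U ∧
          ∀ y, α • (rotGen (U y) - fderiv ℝ U y (rotGen y)) + (1 / 2 : ℝ) • U y
            + (1 / 2 : ℝ) • fderiv ℝ U y y - Laplacian.laplacian U y
            + Literature.Analysis.FluidPDE.convect U U y + gradient P y = 0) →
        (∀ y, ‖U y‖ ≤ K / (1 + ‖y‖)) →
        ∀ y, ‖fderiv ℝ U y‖ ≤ K₁ / (1 + ‖y‖ ^ 2) ∧ ‖fderiv ℝ (fderiv ℝ U) y‖ ≤ K₂ / (1 + ‖y‖ ^ 3) := by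
  intro K _
  obtain ⟨K₁, hK₁0, h₁⟩ := pv_profile_iteratedFDeriv_bounds 1 K
  obtain ⟨K₂, hK₂0, h₂⟩ := pv_profile_iteratedFDeriv_bounds 2 K
  refine ⟨2 * K₁, 2 * K₂, fun α U P hprof hdec y => ?_⟩
  obtain ⟨hU, hP, hdiv, heq⟩ := hprof
  have e₁ := h₁ α U P hU hP hdiv heq hdec y
  have e₂ := h₂ α U P hU hP hdiv heq hdec y
  have hy : 0 ≤ ‖y‖ := norm_nonneg y
  constructor
  · rw [← norm_iteratedFDeriv_zero (𝕜 := ℝ) (f := fderiv ℝ U), norm_iteratedFDeriv_fderiv]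
    calc ‖iteratedFDeriv ℝ (0 + 1) U y‖ ≤ K₁ * ((max ‖y‖ 1)⁻¹) ^ (1 + 1) := e₁
      _ ≤ K₁ * (2 / (1 + ‖y‖ ^ 2)) := mul_le_mul_of_nonneg_left (inv_max_one_pow_le_two_div hy 2) hK₁0
      _ = 2 * K₁ / (1 + ‖y‖ ^ 2) := by ring
  · rw [← norm_iteratedFDeriv_zero (𝕜 := ℝ) (f := fderiv ℝ (fderiv ℝ U)), norm_iteratedFDeriv_fderiv,
      norm_iteratedFDeriv_fderiv]
    calc ‖iteratedFDeriv ℝ (0 + 1 + 1) U y‖ ≤ K₂ * ((max ‖y‖ 1)⁻¹) ^ (2 + 1) := e₂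
      _ ≤ K₂ * (2 / (1 + ‖y‖ ^ 3)) := mul_le_mul_of_nonneg_left (inv_max_one_pow_le_two_div hy 3) hK₂0
      _ = 2 * K₂ / (1 + ‖y‖ ^ 3) := by ring

/-- **Sup-norm form** (the shape of the toolkit's record `PVBounds U K'`): for every `K > 0` there is `K' ≥ 0` (depending on
`K` only) with `‖U(y)‖ ≤ K'`, `‖DU(y)‖ ≤ K'`, `‖D²U(y)‖ ≤ K'` for every Pineau–Vicol-frame profile at any rate `α` with
`‖U(y)‖ ≤ K/(1+‖y‖)`. [cite: PineauVicol2026, Lemma 2.1 (2.1) (arXiv:2607.09619 p. 9)] -/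
theorem pv_profile_sup_bounds :
    ∀ K : ℝ, 0 < K → ∃ K' : ℝ, 0 ≤ K' ∧
      ∀ (α : ℝ) (U : EuclideanSpace ℝ (Fin 3) → EuclideanSpace ℝ (Fin 3)) (P : EuclideanSpace ℝ (Fin 3) → ℝ),
        (ContDiff ℝ (⊤ : ℕ∞) U ∧ ContDiff ℝ 2 P ∧ Literature.Analysis.FluidPDE.VectorCalculus.IsDivFree U ∧
          ∀ y, α • (rotGen (U y) - fderiv ℝ U y (rotGen y)) + (1 / 2 : ℝ) • U y
            + (1 / 2 : ℝ) • fderiv ℝ U y y - Laplacian.laplacian U y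
            + Literature.Analysis.FluidPDE.convect U U y + gradient P y = 0) →
        (∀ y, ‖U y‖ ≤ K / (1 + ‖y‖)) →
        ∀ y, ‖U y‖ ≤ K' ∧ ‖fderiv ℝ U y‖ ≤ K' ∧ ‖iteratedFDeriv ℝ 2 U y‖ ≤ K' := by
  intro K hK
  obtain ⟨K₁, hK₁0, h₁⟩ := pv_profile_iteratedFDeriv_bounds 1 K
  obtain ⟨K₂, hK₂0, h₂⟩ := pv_profile_iteratedFDeriv_bounds 2 K
  refine ⟨max K (max K₁ K₂), le_max_of_le_left hK.le, fun α U P hprof hdec y => ?_⟩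
  obtain ⟨hU, hP, hdiv, heq⟩ := hprof
  -- the factor `max{‖y‖,1}^{−m} ≤ 1`
  have hfac : ∀ m : ℕ, ((max ‖y‖ 1)⁻¹) ^ m ≤ 1 := fun m =>
    pow_le_one₀ (inv_nonneg.2 (le_trans zero_le_one (le_max_right _ _)))
      (inv_le_one_of_one_le₀ (le_max_right _ _))
  refine ⟨?_, ?_, ?_⟩
  · exact ((hdec y).trans (div_le_self hK.le (by linarith [norm_nonneg y]))).trans (le_max_left _ _)
  · rw [← norm_iteratedFDeriv_zero (𝕜 := ℝ) (f := fderiv ℝ U), norm_iteratedFDeriv_fderiv]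
    calc ‖iteratedFDeriv ℝ (0 + 1) U y‖ ≤ K₁ * ((max ‖y‖ 1)⁻¹) ^ (1 + 1) := h₁ α U P hU hP hdiv heq hdec y
      _ ≤ K₁ * 1 := mul_le_mul_of_nonneg_left (hfac _) hK₁0
      _ ≤ max K (max K₁ K₂) := by rw [mul_one]; exact le_max_of_le_right (le_max_left _ _)
  · calc ‖iteratedFDeriv ℝ 2 U y‖ ≤ K₂ * ((max ‖y‖ 1)⁻¹) ^ (2 + 1) := h₂ α U P hU hP hdiv heq hdec y
      _ ≤ K₂ * 1 := mul_le_mul_of_nonneg_left (hfac _) hK₂0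
      _ ≤ max K (max K₁ K₂) := by rw [mul_one]; exact le_max_of_le_right (le_max_right _ _)

end Summit.NavierStokesRegularity.NavierStokesRegularity.Theorems.CoriolisHead

end
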